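import Summits.AtomisticToContinuum.Crystallization.Theorems.FreeSplittingCertificatesRadiusLadderRefValue
import Summits.AtomisticToContinuum.Crystallization.Theorems.MinMeanCycleStackingLockBarlowEnergyIdentification
import Summits.AtomisticToContinuum.Crystallization.Theorems.PhononSlackCertificatesPeriodicGivenLayeredRegistry
import Summits.AtomisticToContinuum.Crystallization.Theorems.PhononSlackCertificatesPeriodicGivenLayeredClosing1
import Summits.AtomisticToContinuum.Crystallization.Theorems.PricedLinkCensusStackingHingeLjSummable

/-!
# `FiniteRangeSplitting` (stmt-AtomisticToContinuum-12559): fragments of ANY Barlow stacking never refute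

Companion of `FreeSplittingCertificatesRadiusLadderRefValue` (block-2b unit `b2b-freesplit-A`, gen 10).  VALUE = a
theorem retiring, BY NAME and at every radius, the whole family of STACKING zoos — finite pieces of periodic Barlow
stackings of ANY Hägg word (hcp, fcc, dhcp, 9R, Fibonacci / Thue–Morse / random windows periodised, …) — as
stand-alone refuters of the radius ladder `RungAt δ R`; NOT summit progress, nothing here closes an item.

`not_refuting_of_hcp_fragments` (gen 7) covers the alternating word only (vertex-transitivity of hcp).  A general
Barlow stacking is not vertex-transitive, and its site energies genuinely depend on the site's layer.  The
replacement for homogeneity is SITEWISE MINIMALITY OF HCP: on the relaxation box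
`B = {47/50 ≤ a ≤ 1, 39a/50 ≤ h ≤ 17a/20}` (which contains the ideal spacing `h = a√(2/3)` and the LP-binding
member `a* = 0.9712` of the R = 2 zoo), for every Hägg word `s` and every layer `m`,

  `barlowSiteEnergy V_LJ a h alternatingHagg m ≤ barlowSiteEnergy V_LJ a h s m`     (`barlowSiteEnergy_hcp_le`)

— every site of every stacking has Lennard-Jones energy at least the hcp site energy at the same spacings.  This is
assembled from results other routes landed in the tree: the layer identity `barlowSiteEnergy_eq`
(`e = e₀ + ½(forward + backward registry energies)`), the registry facts `LayeredHull.stub_registry` (the coupling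
`D_a(H) = barlowCoupling V_LJ a H 1` is `≤ 0` and non-decreasing for `H ≥ 39a/25`; with the height reindexing
`PricedHcpWindowsLjSummable.ljs_barlowCoupling_eq`, `J_k(a,h) = D_a(kh)`), and the Bétermin–Petrache pairing
majorisation `LayeredHull.haggLocalEnergy_alternating_add_deficit_le` / `LayeredHull.clo_backward_le` (in a Hägg
word the ranges `k, k+1` are never both aligned, so `Σ_{k ≥ 2 aligned} J_k ≥ Σ_{k ≥ 2 even} J_k`).

Then, for a `p`-periodic Hägg word (any `p`): the punctured Lennard-Jones sum over the stacking seen from a site of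
layer `m` is `2 · barlowSiteEnergy` (`tsum_points_eq_two_mul_barlowSiteEnergy`, in-layer translations
`latticeSiteSum_add`), all pair distances on the box are `≥ (83/100)^{1/2} > 2^{-1/6}` (`barlow_min_le_dist_sq`: in-layer
`a²`, adjacent layers `a²/3 + h²` by the Hägg offset, two layers `4h²`) so the configuration is attractive and
finite fragments only lose non-positive terms (`latticeSiteSum_le_sum_of_attractive`), and the hcp site energy is
the energy per particle of `hcpPeriodicConfiguration`, which bounds `e_∞` from above (`periodicUpperBound_proof`):

* `halfRule_feasibleOn_barlow_periodic` — `e_∞ ≤ siteE R (1/2) x i` at every site of every finite injective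
  fragment of `barlowStacking a h s`, `47/50 ≤ a ≤ 1`, `39a/50 ≤ h`, `s` a periodic Hägg word, every `R`;
* `exists_periodic_of_fragment` — a finite fragment of the stacking of ANY Hägg word is a fragment of the stacking
  of a PERIODIC one (`periodiseWord`: periodise the word outside the fragment's layer window; the layer labels on
  the window are unchanged, `haggLabel_eq_of_eqOn`), hence `halfRule_feasibleOn_barlow` for every Hägg word —
  periodic, quasi-periodic (Fibonacci, Thue–Morse, …) or random;
* `not_refuting_of_barlow_fragments`, `not_refuting_of_ideal_barlow_fragments` — a zoo of such fragments (any
  mixture of words, spacings in the box resp. ideal spacings `h = a√(2/3)`, radii, shapes) is never in the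
  hypothesis shape of `not_rungAt_of_zoo`, at any radius.

So the aperiodic stacking zoos of the unit (RESULTS-R2 §6 P20, jobs j055768/70/71) are dead as refuters before any LP
is run; the unit's interval certificate `stackmin_cert.py` extends the sitewise minimality numerically-rigorously to
all `a ≥ 2^{-1/6}` at the ideal spacing (and the crude regime `4/5 ≤ a ≤ 2^{-1/6}`), outside the kernel.
-/

noncomputable section
namespace Summit.AtomisticToContinuum.Crystallization.Theorems.StrictSplittingRuleBirth

open scoped BigOperators Classical
open Literature.MathematicalPhysics.StatisticalMechanics

/-- Euclidean `3`-space. -/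
local notation "E3" => EuclideanSpace ℝ (Fin 3)

/-! ## The Lennard-Jones registry couplings on the box -/

/-- **Coupling facts at uniform heights.** On the box the interlayer couplings
`J_k(a,h) = barlowCoupling V_LJ a h k = D_a(k h)` are summable, `≤ 0` and non-decreasing from `k = 2` on
(`LayeredHull.stub_registry`, reindexed by `ljs_barlowCoupling_eq`). [folklore] -/
theorem lj_coupling_facts {a h : ℝ} (ha : 47 / 50 ≤ a) (ha1 : a ≤ 1) (hh : 39 / 50 * a ≤ h) :
    Summable (fun k : ℕ => barlowCoupling lennardJones a h k) ∧
    (∀ k : ℕ, 2 ≤ k → barlowCoupling lennardJones a h k ≤ 0) ∧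
    (∀ k : ℕ, 2 ≤ k → barlowCoupling lennardJones a h k ≤ barlowCoupling lennardJones a h (k + 1)) := by
  have ha0 : 0 < a := by linarith
  have hh0 : 0 < h := by nlinarith
  have hre : ∀ k : ℕ, barlowCoupling lennardJones a h k =
      barlowCoupling lennardJones a ((k : ℝ) * h) 1 := fun k => by
    rw [PricedHcpWindowsLjSummable.ljs_barlowCoupling_eq lennardJones a h k,
      PricedHcpWindowsLjSummable.ljs_barlowCoupling_eq lennardJones a ((k : ℝ) * h) 1]
    simp only [Nat.cast_one, one_mul]
  obtain ⟨c₀, -, hreg⟩ := LayeredHull.stub_registry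
  obtain ⟨hreg1, -⟩ := hreg a ha ha1
  have h156 : ∀ k : ℕ, 2 ≤ k → 39 / 25 * a ≤ (k : ℝ) * h := fun k hk => by
    have hk' : (2 : ℝ) ≤ k := by exact_mod_cast hk
    nlinarith [mul_le_mul_of_nonneg_right hk' hh0.le]
  refine ⟨?_, fun k hk => ?_, fun k hk => ?_⟩
  · show Summable fun k : ℕ => layerInteraction lennardJones a h 0 k - layerInteraction lennardJones a h 1 k
    exact (summable_layerInteraction_lennardJones ha0 hh0 0).sub
      (summable_layerInteraction_lennardJones ha0 hh0 1)
  · rw [hre]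
    exact (hreg1 _ _ (h156 k hk) le_rfl).1
  · rw [hre, hre]
    have hle : (k : ℝ) * h ≤ ((k + 1 : ℕ) : ℝ) * h := by
      push_cast
      nlinarith [hh0]
    exact (hreg1 _ _ (h156 k hk) hle).2

/-! ## hcp is sitewise minimal among Barlow stackings -/

/-- **Sitewise minimality of hcp (Lennard-Jones, box).** For `(a,h)` in the box and every Hägg word `s`, the
energy of a site of layer `m` of the stacking `s` is at least the energy of a site of layer `m` of hcp at the same
spacings. [folklore; the pairing is Bétermin–Petrache, arXiv:1607.08716, Thm 1.1 Step 2.3] -/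
theorem barlowSiteEnergy_hcp_le {a h : ℝ} (ha : 47 / 50 ≤ a) (ha1 : a ≤ 1) (hh : 39 / 50 * a ≤ h)
    {s : ℤ → ℤ} (hs : IsHaggSeq s) (m : ℤ) :
    barlowSiteEnergy lennardJones a h alternatingHagg m ≤ barlowSiteEnergy lennardJones a h s m := by
  have ha0 : 0 < a := by linarith
  have hh0 : 0 < h := by nlinarith
  have hA := summable_layerInteraction_lennardJones ha0 hh0 0
  have hN := summable_layerInteraction_lennardJones ha0 hh0 1
  obtain ⟨hJ, hJ0, hmono⟩ := lj_coupling_facts ha ha1 hh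
  rw [barlowSiteEnergy_eq _ a h hs hA hN m, barlowSiteEnergy_eq _ a h isHaggSeq_alternating hA hN m]
  have hF := LayeredHull.haggLocalEnergy_alternating_add_deficit_le hs hJ hJ0 hmono m
  have hB := LayeredHull.clo_backward_le hs hJ hJ0 hmono m
  have h32 : 0 ≤ barlowCoupling lennardJones a h 3 - barlowCoupling lennardJones a h 2 := by
    linarith [hmono 2 le_rfl]
  have hnn : (0 : ℝ) ≤ (if HaggAligned s m 2 then (0 : ℝ) else 1) := by split_ifs <;> norm_num
  nlinarith [mul_nonneg h32 hnn]

/-- The hcp site energy does not depend on the layer. [folklore] -/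
theorem barlowSiteEnergy_alternating_eq_zero {a h : ℝ} (ha0 : 0 < a) (hh0 : 0 < h) (m : ℤ) :
    barlowSiteEnergy lennardJones a h alternatingHagg m = barlowSiteEnergy lennardJones a h alternatingHagg 0 := by
  have hA := summable_layerInteraction_lennardJones ha0 hh0 0
  have hN := summable_layerInteraction_lennardJones ha0 hh0 1
  rw [barlowSiteEnergy_eq _ a h isHaggSeq_alternating hA hN m,
    barlowSiteEnergy_eq _ a h isHaggSeq_alternating hA hN 0,
    LayeredHull.clo_haggBackwardLocalEnergy_alternating, LayeredHull.clo_haggBackwardLocalEnergy_alternating,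
    haggLocalEnergy_alternating, haggLocalEnergy_alternating]

/-- **`e_∞ ≤` the hcp site energy** at any spacings `a, h > 0` (periodic upper bound at `hcpPeriodicConfiguration`,
whose energy per particle is the common value of its site energies). [folklore] -/
theorem eInf_le_barlowSiteEnergy_alternating {a h : ℝ} (ha0 : 0 < a) (hh0 : 0 < h) (m : ℤ) :
    eInf ≤ barlowSiteEnergy lennardJones a h alternatingHagg m := by
  have hub : eInf ≤ (barlowPeriodicConfiguration alternatingHagg ha0.ne' hh0.ne' two_ne_zero
      alternatingHagg_periodic).energyPerParticle lennardJones := periodicUpperBound_proof _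
  rw [energyPerParticle_barlow_eq_average ha0 hh0 ha0.ne' hh0.ne' two_ne_zero alternatingHagg_periodic] at hub
  simp only [Finset.sum_range_succ, Finset.sum_range_zero, zero_add, Nat.cast_zero, Nat.cast_one] at hub
  rw [barlowSiteEnergy_alternating_eq_zero ha0 hh0 1] at hub
  rw [barlowSiteEnergy_alternating_eq_zero ha0 hh0 m]
  linarith

/-! ## Distances in a Hägg stacking -/

/-- `(a√3/2 · Y)² = ¾ (aY)²`. [folklore] -/
theorem sq_sqrt3_aux (a Y : ℝ) : (a * √3 / 2 * Y) ^ 2 = 3 / 4 * (a * Y) ^ 2 := by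
  rw [show a * √3 / 2 * Y = √3 * (a * Y / 2) by ring, mul_pow, Real.sq_sqrt (by norm_num : (0 : ℝ) ≤ 3)]
  ring

/-- **Nearest distances in a Barlow stacking of a Hägg word.** Two distinct sites are at squared distance
`≥ min (min a² (4h²)) (a²/3 + h²)`: in-layer `≥ a²`; adjacent layers carry different letters, so the lateral offset
is `≥ a/√3` and the squared distance `≥ a²/3 + h²`; two or more layers apart `≥ 4h²`.  No hypothesis on `a, h`.
[folklore] -/
theorem barlow_min_le_dist_sq (a h : ℝ) {s : ℤ → ℤ} (hs : IsHaggSeq s) {k i j k' i' j' : ℤ}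
    (hne : (k, i, j) ≠ (k', i', j')) :
    min (min (a ^ 2) (4 * h ^ 2)) (a ^ 2 / 3 + h ^ 2) ≤
      dist (barlowPos a h s k i j) (barlowPos a h s k' i' j') ^ 2 := by
  rw [dist_barlowPos_sq, sq_sqrt3_aux]
  by_cases hk : k = k'
  · -- same layer
    subst hk
    have hij : (i - i', j - j') ≠ ((0 : ℤ), (0 : ℤ)) := by
      intro h0
      simp only [Prod.mk.injEq, sub_eq_zero] at h0
      exact hne (by rw [h0.1, h0.2])
    have hform : (1 : ℝ) ≤ ((i : ℝ) - i') ^ 2 + ((i : ℝ) - i') * ((j : ℝ) - j') + ((j : ℝ) - j') ^ 2 := by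
      have := one_le_sq_add_mul_add_sq (p := i - i') (q := j - j') hij
      exact_mod_cast this
    refine ((min_le_left _ _).trans (min_le_left _ _)).trans ?_
    simp only [sub_self, zero_div, add_zero, zero_mul]
    nlinarith [sq_nonneg a, sq_nonneg h, mul_nonneg (sq_nonneg a) (sub_nonneg.2 hform)]
  by_cases h1 : k = k' + 1 ∨ k' = k + 1
  · -- adjacent layers: the label difference is `± 1`
    refine (min_le_right _ _).trans ?_
    have key : ∀ v : ℤ, 0 ≤ 12 * v + 4 → 0 ≤ v := fun v hv => by omega
    -- the lateral form with offset `d = ±1` is `p² + pq + q² + d(p+q) + 1/3 ≥ 1/3`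
    have lat : ∀ d : ℤ, (d = 1 ∨ d = -1) →
        a ^ 2 / 3 ≤ (a * (((i : ℝ) - i') + ((j : ℝ) - j') / 2 + (d : ℝ) / 2)) ^ 2 +
          3 / 4 * (a * (((j : ℝ) - j') + (d : ℝ) / 3)) ^ 2 := by
      intro d hd
      have hv : (0 : ℤ) ≤ (i - i') ^ 2 + (i - i') * (j - j') + (j - j') ^ 2 + d * ((i - i') + (j - j')) := by
        rcases hd with rfl | rfl
        · exact key _ (by nlinarith [sq_nonneg (2 * (i - i') + (j - j') + 1), sq_nonneg (3 * (j - j') + 1)])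
        · exact key _ (by nlinarith [sq_nonneg (2 * (i - i') + (j - j') - 1), sq_nonneg (3 * (j - j') - 1)])
      have hv' : (0 : ℝ) ≤ ((i : ℝ) - i') ^ 2 + ((i : ℝ) - i') * ((j : ℝ) - j') + ((j : ℝ) - j') ^ 2 +
          (d : ℝ) * (((i : ℝ) - i') + ((j : ℝ) - j')) := by exact_mod_cast hv
      have hd2 : (d : ℝ) ^ 2 = 1 := by
        rcases hd with rfl | rfl <;> norm_num
      have had2 : a ^ 2 * (d : ℝ) ^ 2 = a ^ 2 := by rw [hd2, mul_one]
      nlinarith [sq_nonneg a, mul_nonneg (sq_nonneg a) hv', had2]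
    rcases h1 with rfl | rfl
    · -- k = k' + 1
      rw [haggLabel_succ]
      push_cast
      have := lat (s k') (hs k')
      nlinarith [this, sq_nonneg h]
    · -- k' = k + 1
      rw [haggLabel_succ]
      push_cast
      have hsk : (-s k = 1 ∨ -s k = -1) := by rcases hs k with h0 | h0 <;> rw [h0] <;> norm_num
      have := lat (-s k) hsk
      push_cast at this
      nlinarith [this, sq_nonneg h]
  · -- two or more layers apart
    push Not at h1
    have h2 : (2 : ℤ) ≤ |k - k'| := by
      rcases lt_or_gt_of_ne (sub_ne_zero.2 hk) with hlt | hgt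
      · rw [abs_of_neg hlt]; omega
      · rw [abs_of_pos hgt]; omega
    have h4 : (4 : ℝ) ≤ ((k : ℝ) - k') ^ 2 := by
      have h4z : (4 : ℤ) ≤ (k - k') ^ 2 := by nlinarith [h2, sq_abs (k - k'), abs_nonneg (k - k')]
      exact_mod_cast h4z
    refine ((min_le_left _ _).trans (min_le_right _ _)).trans ?_
    nlinarith [sq_nonneg (a * (((i : ℝ) - i') + ((j : ℝ) - j') / 2 + ((haggLabel s k : ℝ) - haggLabel s k') / 2)),
      sq_nonneg (a * (((j : ℝ) - j') + ((haggLabel s k : ℝ) - haggLabel s k') / 3)), sq_nonneg h,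
      mul_nonneg (sub_nonneg.2 h4) (sq_nonneg h)]

/-- **Barlow stackings on the box are attractive**: every pair of distinct sites has `V_LJ ≤ 0`
(all squared distances are `≥ 83/100`, and `(83/100)³ ≥ 1/2`). [folklore] -/
theorem lennardJones_nonpos_of_mem_barlowStacking {a h : ℝ} (ha : 47 / 50 ≤ a) (hh : 39 / 50 * a ≤ h)
    {s : ℤ → ℤ} (hs : IsHaggSeq s) {z z' : E3} (hz : z ∈ barlowStacking a h s)
    (hz' : z' ∈ barlowStacking a h s) (hzz' : z ≠ z') : lennardJones (dist z z') ≤ 0 := by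
  obtain ⟨k, i, j, rfl⟩ := hz
  obtain ⟨k', i', j', rfl⟩ := hz'
  have hne : (k, i, j) ≠ (k', i', j') := by
    rintro heq
    simp only [Prod.mk.injEq] at heq
    obtain ⟨rfl, rfl, rfl⟩ := heq
    exact hzz' rfl
  have hmin := barlow_min_le_dist_sq a h hs hne
  have ha2 : (8836 : ℝ) / 10000 ≤ a ^ 2 := by nlinarith
  have hh2 : (1521 : ℝ) / 2500 * a ^ 2 ≤ h ^ 2 := by
    have h0 : 0 ≤ 39 / 50 * a := by linarith
    nlinarith [mul_le_mul hh hh h0 (h0.trans hh)]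
  have hlow : (83 : ℝ) / 100 ≤ min (min (a ^ 2) (4 * h ^ 2)) (a ^ 2 / 3 + h ^ 2) :=
    le_min (le_min (by linarith) (by nlinarith)) (by nlinarith)
  apply lennardJones_nonpos_of_half_le_sq_cube
  have hd : (83 : ℝ) / 100 ≤ dist (barlowPos a h s k i j) (barlowPos a h s k' i' j') ^ 2 := hlow.trans hmin
  calc (1 : ℝ) / 2 ≤ ((83 : ℝ) / 100) ^ 3 := by norm_num
    _ ≤ _ := by gcongr

/-! ## Periodic words -/

/-- **Periodic Barlow fragments never refute (half rule).**  For `47/50 ≤ a ≤ 1`, `39a/50 ≤ h` (the upper edge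
`h ≤ 17a/20` of the box is not needed) and a `p`-periodic Hägg word `s` (any period `p`), the half rule is feasible
— `e_∞ ≤ siteE R (1/2) x i` — at every site of every finite injective fragment `x ⊆ barlowStacking a h s`, at
EVERY radius `R`. -/
theorem halfRule_feasibleOn_barlow_periodic {a h : ℝ} (ha : 47 / 50 ≤ a) (ha1 : a ≤ 1) (hh : 39 / 50 * a ≤ h)
    {s : ℤ → ℤ} (hs : IsHaggSeq s) {p : ℕ} (hp : p ≠ 0) (hper : ∀ i, s (i + p) = s i)
    (R : ℝ) {N : ℕ} {x : Fin N → E3} (hx : Function.Injective x)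
    (hxS : ∀ i, x i ∈ barlowStacking a h s) (i : Fin N) :
    eInf ≤ siteE R halfRule x i := by
  have ha0 : 0 < a := by linarith
  have hh0 : 0 < h := by nlinarith
  set P := barlowPeriodicConfiguration s ha0.ne' hh0.ne' hp hper with hPdef
  have hP : P.points = barlowStacking a h s := barlowPeriodicConfiguration_points s ha0.ne' hh0.ne' hp hper
  have hxP : ∀ i, x i ∈ P.points := fun i => by rw [hP]; exact hxS i
  have hV : ∀ z ∈ P.points, ∀ z' ∈ P.points, z ≠ z' → lennardJones (dist z z') ≤ 0 := by
    intro z hz z' hz' hzz'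
    rw [hP] at hz hz'
    exact lennardJones_nonpos_of_mem_barlowStacking ha hh hs hz hz' hzz'
  -- the finite fragment only loses non-positive terms
  have hfrag := latticeSiteSum_le_sum_of_attractive P hV hx hxP i
  -- the site sum at `x i` is the site sum at the base point of its layer, `2 · barlowSiteEnergy`
  obtain ⟨m, i', j', hxi⟩ := hxS i
  have hg : (i' : ℝ) • triangularVec₁ a + (j' : ℝ) • triangularVec₂ a ∈
      barlowPeriodLattice s ha0.ne' hh0.ne' hp := by
    have := sum_smul_mem_barlowPeriodLattice s ha0.ne' hh0.ne' hp i' j' 0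
    simpa using this
  have heq : x i = barlowPos a h s m 0 0 + ((i' : ℝ) • triangularVec₁ a + (j' : ℝ) • triangularVec₂ a) := by
    rw [hxi]
    simp only [barlowPos, Int.cast_zero, zero_smul, zero_add]
    abel
  have htrans : latticeSiteSum P (x i) = latticeSiteSum P (barlowPos a h s m 0 0) := by
    rw [heq]
    exact latticeSiteSum_add P _ hg
  have hsite : latticeSiteSum P (barlowPos a h s m 0 0) = 2 * barlowSiteEnergy lennardJones a h s m :=
    tsum_points_eq_two_mul_barlowSiteEnergy ha0 hh0 ha0.ne' hh0.ne' hp hper m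
  have hcmp := barlowSiteEnergy_hcp_le ha ha1 hh hs m
  have hinf := eInf_le_barlowSiteEnergy_alternating ha0 hh0 m
  rw [siteE_halfRule]
  rw [htrans, hsite] at hfrag
  linarith

/-! ## Arbitrary words: periodise outside the fragment -/

/-- **Periodisation of a word outside the window `[-K, K]`** with period `2K + 1`. [folklore] -/
def periodiseWord (s : ℤ → ℤ) (K : ℕ) : ℤ → ℤ :=
  fun k => s ((k + K) % ((2 * K + 1 : ℕ) : ℤ) - K)

/-- The periodised word is `(2K+1)`-periodic. [folklore] -/
theorem periodiseWord_periodic (s : ℤ → ℤ) (K : ℕ) (i : ℤ) :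
    periodiseWord s K (i + ((2 * K + 1 : ℕ) : ℤ)) = periodiseWord s K i := by
  unfold periodiseWord
  rw [show i + ((2 * K + 1 : ℕ) : ℤ) + K = i + K + ((2 * K + 1 : ℕ) : ℤ) by ring]
  simp

/-- The periodised word agrees with the word on the window `[-K, K]`. [folklore] -/
theorem periodiseWord_eq (s : ℤ → ℤ) (K : ℕ) {k : ℤ} (hk : -(K : ℤ) ≤ k) (hk' : k ≤ K) :
    periodiseWord s K k = s k := by
  unfold periodiseWord
  congr 1
  have h0 : 0 ≤ k + K := by omega
  have h1 : k + K < ((2 * K + 1 : ℕ) : ℤ) := by push_cast; omega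
  rw [Int.emod_eq_of_lt h0 h1]
  ring

/-- The periodisation of a Hägg word is a Hägg word. [folklore] -/
theorem isHaggSeq_periodiseWord {s : ℤ → ℤ} (hs : IsHaggSeq s) (K : ℕ) : IsHaggSeq (periodiseWord s K) :=
  fun _ => hs _

/-- Words agreeing on `[-K, K)` have the same layer labels on `[-K, K]`. [folklore] -/
theorem haggLabel_eq_of_eqOn {s s' : ℤ → ℤ} {K : ℕ} (hss' : ∀ k : ℤ, -(K : ℤ) ≤ k → k < K → s' k = s k)
    {k : ℤ} (hk : -(K : ℤ) ≤ k) (hk' : k ≤ K) : haggLabel s' k = haggLabel s k := by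
  rcases le_or_gt 0 k with h0 | h0
  · obtain ⟨n, rfl⟩ : ∃ n : ℕ, k = n := ⟨k.toNat, by omega⟩
    rw [haggLabel_natCast, haggLabel_natCast, haggWindow, haggWindow]
    refine Finset.sum_congr rfl fun i hi => ?_
    rw [Finset.mem_range] at hi
    exact hss' _ (by omega) (by omega)
  · obtain ⟨n, rfl⟩ : ∃ n : ℕ, k = -(n : ℤ) := ⟨(-k).toNat, by omega⟩
    rw [haggLabel_neg_natCast, haggLabel_neg_natCast, haggWindow, haggWindow]
    congr 1
    refine Finset.sum_congr rfl fun i hi => ?_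
    rw [Finset.mem_range] at hi
    exact hss' _ (by omega) (by omega)

/-- A finite fragment of the stacking of ANY Hägg word is a fragment of the stacking of a PERIODIC Hägg word
(the periodisation of the word outside the fragment's layer window). [folklore] -/
theorem exists_periodic_of_fragment (a h : ℝ) {s : ℤ → ℤ} (hs : IsHaggSeq s) {N : ℕ} {x : Fin N → E3}
    (hxS : ∀ i, x i ∈ barlowStacking a h s) :
    ∃ (s' : ℤ → ℤ) (p : ℕ), IsHaggSeq s' ∧ p ≠ 0 ∧ (∀ i, s' (i + p) = s' i) ∧
      ∀ i, x i ∈ barlowStacking a h s' := by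
  have hxS2 : ∀ i, ∃ k i' j' : ℤ, x i = barlowPos a h s k i' j' := fun i => hxS i
  choose kf i_f j_f hxf using hxS2
  obtain ⟨K, hK⟩ : ∃ K : ℕ, ∀ i, (kf i).natAbs ≤ K :=
    ⟨Finset.univ.sup fun i => (kf i).natAbs, fun i =>
      Finset.le_sup (f := fun i => (kf i).natAbs) (Finset.mem_univ i)⟩
  refine ⟨periodiseWord s K, 2 * K + 1, isHaggSeq_periodiseWord hs K, by omega, periodiseWord_periodic s K,
    fun i => ⟨kf i, i_f i, j_f i, ?_⟩⟩
  have hL : haggLabel (periodiseWord s K) (kf i) = haggLabel s (kf i) :=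
    haggLabel_eq_of_eqOn (fun k hk hk' => periodiseWord_eq s K hk hk'.le)
      (by have := hK i; omega) (by have := hK i; omega)
  rw [hxf i]
  unfold barlowPos
  rw [hL]

/-- **Barlow fragments never refute (half rule), ANY Hägg word.**  For `47/50 ≤ a ≤ 1`, `39a/50 ≤ h` and every
Hägg word `s` (periodic or not), the half rule is feasible — `e_∞ ≤ siteE R (1/2) x i` — at every site of every
finite injective fragment `x ⊆ barlowStacking a h s`, at EVERY radius `R`. -/
theorem halfRule_feasibleOn_barlow {a h : ℝ} (ha : 47 / 50 ≤ a) (ha1 : a ≤ 1) (hh : 39 / 50 * a ≤ h)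
    {s : ℤ → ℤ} (hs : IsHaggSeq s) (R : ℝ) {N : ℕ} {x : Fin N → E3} (hx : Function.Injective x)
    (hxS : ∀ i, x i ∈ barlowStacking a h s) (i : Fin N) :
    eInf ≤ siteE R halfRule x i := by
  obtain ⟨s', p, hs', hp, hper, hxS'⟩ := exists_periodic_of_fragment a h hs hxS
  exact halfRule_feasibleOn_barlow_periodic ha ha1 hh hs' hp hper R hx hxS' i

/-- The ideal spacing `h = a√(2/3)` lies in the box for every `a > 0` (`39/50 < √(2/3) = 0.8164… < 17/20`). -/
theorem ideal_height_mem_box {a : ℝ} (ha0 : 0 < a) :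
    39 / 50 * a ≤ a * Real.sqrt (2 / 3) ∧ a * Real.sqrt (2 / 3) ≤ 17 / 20 * a := by
  have hs : Real.sqrt (2 / 3) ^ 2 = 2 / 3 := Real.sq_sqrt (by norm_num)
  have hs0 : 0 ≤ Real.sqrt (2 / 3) := Real.sqrt_nonneg _
  have hlo : (39 : ℝ) / 50 ≤ Real.sqrt (2 / 3) := by nlinarith [hs, hs0]
  have hhi : Real.sqrt (2 / 3) ≤ (17 : ℝ) / 20 := by nlinarith [hs, hs0]
  constructor <;> nlinarith [hlo, hhi, ha0]

/-- **A zoo of Barlow fragments is never refuting.**  If every configuration of `Z` is an injective fragment of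
some Barlow stacking `barlowStacking a h s` (`s` ANY Hägg word — periodic, quasi-periodic, random —, spacings
`47/50 ≤ a ≤ 1`, `39a/50 ≤ h`; words and spacings may differ between configurations), then at every radius `R` the
half rule is feasible on all of `Z`, so `Z` is not in the hypothesis shape of `not_rungAt_of_zoo`. -/
theorem not_refuting_of_barlow_fragments (R : ℝ) (Z : Finset (Σ N : ℕ, Fin N → E3))
    (hZ : ∀ c ∈ Z, Function.Injective c.2 ∧
      ∃ (a h : ℝ) (s : ℤ → ℤ), 47 / 50 ≤ a ∧ a ≤ 1 ∧ 39 / 50 * a ≤ h ∧ IsHaggSeq s ∧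
        ∀ i, c.2 i ∈ barlowStacking a h s) :
    ¬ ∀ Ψ : E3 → Finset E3 → ℝ, IsRule Ψ → ∃ c ∈ Z, ∃ i : Fin c.1, siteE R Ψ c.2 i < eInf := by
  intro href
  obtain ⟨c, hc, i, hlt⟩ := href halfRule isRule_halfRule
  obtain ⟨hx, a, h, s, ha, ha1, hh, hs, hxS⟩ := hZ c hc
  exact (not_lt.2 (halfRule_feasibleOn_barlow ha ha1 hh hs R hx hxS i)) hlt

/-- In particular for IDEAL stackings `h = a√(2/3)`, `47/50 ≤ a ≤ 1` (the scanned stacking families of the R = 2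
zoo: hcp/fcc balls and slabs, and the aperiodic Fibonacci / Thue–Morse / period-doubling / Rudin–Shapiro / random
stacking balls at `a* = 0.9712`), ANY Hägg word. -/
theorem not_refuting_of_ideal_barlow_fragments (R : ℝ) (Z : Finset (Σ N : ℕ, Fin N → E3))
    (hZ : ∀ c ∈ Z, Function.Injective c.2 ∧
      ∃ (a : ℝ) (s : ℤ → ℤ), 47 / 50 ≤ a ∧ a ≤ 1 ∧ IsHaggSeq s ∧
        ∀ i, c.2 i ∈ barlowStacking a (a * Real.sqrt (2 / 3)) s) :
    ¬ ∀ Ψ : E3 → Finset E3 → ℝ, IsRule Ψ → ∃ c ∈ Z, ∃ i : Fin c.1, siteE R Ψ c.2 i < eInf := by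
  refine not_refuting_of_barlow_fragments R Z fun c hc => ?_
  obtain ⟨hx, a, s, ha, ha1, hs, hxS⟩ := hZ c hc
  have ha0 : 0 < a := by linarith
  exact ⟨hx, a, a * Real.sqrt (2 / 3), s, ha, ha1, (ideal_height_mem_box ha0).1, hs, hxS⟩

/-- The LP-binding member of the R = 2 zoo, `a* = √(1179/1250) = 0.97118…`, lies in the box. -/
example : (47 : ℝ) / 50 ≤ Real.sqrt (1179 / 1250) ∧ Real.sqrt (1179 / 1250) ≤ 1 := by
  constructor
  · rw [show (47 : ℝ) / 50 = Real.sqrt ((47 / 50) ^ 2) by rw [Real.sqrt_sq (by norm_num)]]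
    exact Real.sqrt_le_sqrt (by norm_num)
  · rw [show (1 : ℝ) = Real.sqrt 1 by simp]
    exact Real.sqrt_le_sqrt (by norm_num)

end Summit.AtomisticToContinuum.Crystallization.Theorems.StrictSplittingRuleBirth

end
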